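import Summits.Parity.GeneralizedHardyLittlewood.Theses.LiouvilleShiftedTables
import Literature.NumberTheory.LFunctions.TaoLogChowlaMoebiusOfLiouville
import Literature.NumberTheory.LFunctions.LiouvilleSumClassicalBound

/-!
# `MAvg`: squarefree decomposition of the dilation slices (SieveToMAvg, step (i), pointwise)

Route `LiouvilleShiftedTables`, item `MAvg` (stmt-Parity-14273, = stmt-Parity-0613 by signature):
`∀ h ≥ 1, ∃ ε > 0, ∑_{m ≤ x^ε} log m · |S_m(x)| = o(x)`, `S_m(x) := ∑_{d ≤ x/m} μ(d) Λ(d m + h)`.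

This file carries out, pointwise in `x`, the first step of the route's `SieveToMAvg` plan
(support item stmt-Parity-14274): trading the Möbius function of the cofactor for the Liouville
function, which is completely multiplicative and therefore passes to the shifted prime itself.

* `moebiusSlice_eq_sum_moebius_mul_liouvilleSlice` — from `μ(d) = λ(d) ∑_{k² ∣ d} μ(k)`
  (tree: `Literature.NumberTheory.LFunctions.moebius_eq_liouville_mul_sqfreeInd`,
  `sqfreeInd_eq_sum_moebius`; the same first move as Lichtman 2020 §2) and `λ(k² e) = λ(e)`:
  `S_m(x) = ∑_{k} μ(k) U(x; k² m)`, `U(x; q) := ∑_{e ≤ x/q} λ(e) Λ(e q + h)`.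
* `abs_liouvilleSlice_le` — the trivial bound `|U(x; q)| ≤ (x/q) log (x + h)`.
* `sum_log_mul_abs_moebiusSlice_le` — the MASTER INEQUALITY: for `x ≥ 1`, `ε > 0`, `h ≥ 1` and
  every cut-off `K` with `K² ⌊x^ε⌋ ≤ ⌊x^{2ε}⌋`,
  `∑_{m ≤ x^ε} log m |S_m(x)| ≤ ε log x · (K ∑_{q ≤ x^{2ε}} |U(x; q)| + x log(x+h)(1 + ε log x) · 2/(K+1))`
  (dilations `q = k² m`, `k ≤ K`, injectively in `m` for each `k`; the tail `k > K` trivially via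
  `∑_{m ≤ x^ε} 1/m ≤ 1 + ε log x` and `∑_{k > K} 1/k² ≤ 2/(K+1)`).

The asymptotic consequences (`MAvg` from an `ℓ¹`-level statement for `λ` against `Λ` at level
`x^{2ε}`) are in `LiouvilleShiftedTablesMAvgOfLevel.lean`. Elementary; no new definitions.
-/

open Filter Asymptotics Finset

namespace Summit.Parity.GeneralizedHardyLittlewood.Theorems.MAvg

open ArithmeticFunction
open scoped ArithmeticFunction.Moebius ArithmeticFunction.Omega

/-- `λ(k² e) = λ(e)` for `k ≠ 0` (complete multiplicativity and `λ(k)² = 1`). -/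
theorem liouville_sq_mul_eq {k : ℕ} (hk : k ≠ 0) (e : ℕ) :
    liouville (k ^ 2 * e) = liouville e := by
  have h1 : liouville (k ^ 2) = 1 := by
    rw [sq, liouville_apply_mul, liouville_apply hk, ← pow_add, ← two_mul, pow_mul, neg_one_sq,
      one_pow]
  rw [liouville_apply_mul, h1, one_mul]

/-- Reindexing the multiples of `k²` in `[1, D]` as `d = k² e` with `e ∈ [1, D / k²]`. -/
theorem sum_filter_sq_dvd_Icc_eq_sum_Icc_div {k : ℕ} (hk : k ≠ 0) (D : ℕ) (F : ℕ → ℝ) :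
    ∑ d ∈ (Icc 1 D).filter (fun d => k ^ 2 ∣ d), F d
      = ∑ e ∈ Icc 1 (D / k ^ 2), F (k ^ 2 * e) := by
  have hk2 : 0 < k ^ 2 := by positivity
  symm
  refine Finset.sum_nbij' (fun e => k ^ 2 * e) (fun d => d / k ^ 2) ?_ ?_ ?_ ?_ ?_
  · intro e he
    rw [mem_Icc] at he
    rw [mem_filter, mem_Icc]
    refine ⟨⟨?_, ?_⟩, dvd_mul_right _ _⟩
    · exact Nat.one_le_iff_ne_zero.mpr (Nat.mul_ne_zero hk2.ne' (by omega))
    · rw [mul_comm]; exact (Nat.le_div_iff_mul_le hk2).mp he.2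
  · intro d hd
    rw [mem_filter, mem_Icc] at hd
    rw [mem_Icc]
    refine ⟨(Nat.le_div_iff_mul_le hk2).mpr ?_, Nat.div_le_div_right hd.1.2⟩
    rw [one_mul]; exact Nat.le_of_dvd (by omega) hd.2
  · intro e _
    exact Nat.mul_div_cancel_left e hk2
  · intro d hd
    rw [mem_filter] at hd
    exact Nat.mul_div_cancel' hd.2
  · intro e _
    rfl

/-- **Squarefree decomposition of a dilation slice.** For `m ≥ 1` and any `N ≥ ⌊x/m⌋`,
`∑_{d ≤ x/m} μ(d) Λ(d m + h) = ∑_{k ≤ N} μ(k) ∑_{e ≤ x/(k² m)} λ(e) Λ(e k² m + h)`,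
from `μ(d) = λ(d) ∑_{k² ∣ d} μ(k)` and `λ(k² e) = λ(e)`. -/
theorem moebiusSlice_eq_sum_moebius_mul_liouvilleSlice (x : ℝ) (m h : ℕ)
    {N : ℕ} (hN : ⌊x / m⌋₊ ≤ N) :
    ∑ d ∈ Icc 1 ⌊x / m⌋₊, (μ d : ℝ) * Λ (d * m + h)
      = ∑ k ∈ Icc 1 N, (μ k : ℝ) *
          ∑ e ∈ Icc 1 ⌊x / (k ^ 2 * m : ℕ)⌋₊, (liouville e : ℝ) * Λ (e * (k ^ 2 * m) + h) := by
  set D := ⌊x / m⌋₊ with hD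
  have h1 : ∀ d ∈ Icc 1 D, (μ d : ℝ) * Λ (d * m + h)
      = ∑ k ∈ Icc 1 N, if k ^ 2 ∣ d then (μ k : ℝ) * ((liouville d : ℝ) * Λ (d * m + h))
          else 0 := by
    intro d hd
    rw [mem_Icc] at hd
    rw [Literature.NumberTheory.LFunctions.moebius_eq_liouville_mul_sqfreeInd,
      Literature.NumberTheory.LFunctions.sqfreeInd_eq_sum_moebius (n := d) (N := N) hd.1
        (hd.2.trans hN), Finset.sum_filter, Finset.mul_sum, Finset.sum_mul]
    refine Finset.sum_congr rfl (fun k _ => ?_)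
    split_ifs <;> ring
  rw [Finset.sum_congr rfl h1, Finset.sum_comm]
  refine Finset.sum_congr rfl (fun k hk => ?_)
  rw [mem_Icc] at hk
  have hk0 : k ≠ 0 := by omega
  rw [← Finset.sum_filter, sum_filter_sq_dvd_Icc_eq_sum_Icc_div hk0, Finset.mul_sum]
  have hfloor : D / k ^ 2 = ⌊x / (k ^ 2 * m : ℕ)⌋₊ := by
    rw [hD, ← Nat.floor_div_natCast, Nat.cast_mul, Nat.cast_pow, div_div, mul_comm]
  rw [hfloor]
  refine Finset.sum_congr rfl (fun e _ => ?_)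
  rw [liouville_sq_mul_eq hk0]
  congr 3
  ring

/-- Trivial bound for a Liouville slice: for `x ≥ 0`, `q ≥ 1`, `h ≥ 1`,
`|∑_{e ≤ x/q} λ(e) Λ(e q + h)| ≤ (x/q) · log (x + h)` (each `Λ(e q + h) ≤ log (x + h)`). -/
theorem abs_liouvilleSlice_le {x : ℝ} (hx : 0 ≤ x) {q : ℕ} (hq : 1 ≤ q) {h : ℕ} (hh : 1 ≤ h) :
    |∑ e ∈ Icc 1 ⌊x / q⌋₊, (liouville e : ℝ) * Λ (e * q + h)| ≤ x / q * Real.log (x + h) := by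
  have hq0 : (0 : ℝ) < q := by exact_mod_cast hq
  have hxq : 0 ≤ x / q := div_nonneg hx hq0.le
  have hh' : (1 : ℝ) ≤ h := by exact_mod_cast hh
  have hlog0 : 0 ≤ Real.log (x + h) := Real.log_nonneg (by linarith)
  calc |∑ e ∈ Icc 1 ⌊x / q⌋₊, (liouville e : ℝ) * Λ (e * q + h)|
      ≤ ∑ e ∈ Icc 1 ⌊x / q⌋₊, |(liouville e : ℝ) * Λ (e * q + h)| := Finset.abs_sum_le_sum_abs _ _
    _ ≤ ∑ e ∈ Icc 1 ⌊x / q⌋₊, Real.log (x + h) := by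
        refine Finset.sum_le_sum (fun e he => ?_)
        rw [mem_Icc] at he
        rw [abs_mul, abs_of_nonneg ArithmeticFunction.vonMangoldt_nonneg]
        have h1 : |(liouville e : ℝ)| * Λ (e * q + h) ≤ Λ (e * q + h) := by
          calc |(liouville e : ℝ)| * Λ (e * q + h) ≤ 1 * Λ (e * q + h) :=
                mul_le_mul_of_nonneg_right
                  (Literature.NumberTheory.LFunctions.LiouvilleSum.abs_liouville_le_one e)
                  ArithmeticFunction.vonMangoldt_nonneg
            _ = Λ (e * q + h) := one_mul _
        refine h1.trans (ArithmeticFunction.vonMangoldt_le_log.trans ?_)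
        have he' : (e : ℝ) ≤ x / q := (Nat.le_floor_iff hxq).mp he.2
        have heq : (e : ℝ) * q ≤ x := by rwa [le_div_iff₀ hq0] at he'
        have hpos : 0 < e * q + h := Nat.add_pos_right _ hh
        have hpos' : (0 : ℝ) < ((e * q + h : ℕ) : ℝ) := by exact_mod_cast hpos
        apply Real.log_le_log hpos'
        push_cast
        linarith
    _ = ⌊x / q⌋₊ * Real.log (x + h) := by
        rw [Finset.sum_const, Nat.card_Icc, Nat.add_sub_cancel, nsmul_eq_mul]
    _ ≤ x / q * Real.log (x + h) := mul_le_mul_of_nonneg_right (Nat.floor_le hxq) hlog0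

/-- Tail of `∑ 1/k²`: `∑_{K < k ≤ N} 1/k² ≤ 2/(K+1)`. -/
theorem sum_Ioc_inv_sq_le_two_div (K N : ℕ) :
    ∑ k ∈ Ioc K N, ((k : ℝ) ^ 2)⁻¹ ≤ 2 / (K + 1) := by
  calc ∑ k ∈ Ioc K N, ((k : ℝ) ^ 2)⁻¹ ≤ ∑ k ∈ Ioo K (N + 1), ((k : ℝ) ^ 2)⁻¹ :=
        Finset.sum_le_sum_of_subset_of_nonneg
          (fun k hk => by rw [mem_Ioc] at hk; rw [mem_Ioo]; omega) (fun _ _ _ => by positivity)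
    _ ≤ 2 / (K + 1) := _root_.sum_Ioo_inv_sq_le K (N + 1)

/-- Injectivity of the dilation `m ↦ k² m` on `[1, M]` into `[1, Q]` when `k ≤ K` and `K² M ≤ Q`:
for non-negative `F`, `∑_{m ≤ M} F(k² m) ≤ ∑_{q ≤ Q} F(q)`. -/
theorem sum_Icc_comp_sq_mul_le {k K M Q : ℕ} (hk : 1 ≤ k) (hkK : k ≤ K) (hQ : K ^ 2 * M ≤ Q)
    (F : ℕ → ℝ) (hF : ∀ q, 0 ≤ F q) :
    ∑ m ∈ Icc 1 M, F (k ^ 2 * m) ≤ ∑ q ∈ Icc 1 Q, F q := by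
  have hk2 : 0 < k ^ 2 := by positivity
  rw [← Finset.sum_image (g := fun m => k ^ 2 * m) (f := F)
    (fun a _ b _ hab => Nat.eq_of_mul_eq_mul_left hk2 hab)]
  refine Finset.sum_le_sum_of_subset_of_nonneg ?_ (fun q _ _ => hF q)
  intro q hq
  rw [mem_image] at hq
  obtain ⟨m, hm, rfl⟩ := hq
  rw [mem_Icc] at hm ⊢
  constructor
  · exact Nat.one_le_iff_ne_zero.mpr (Nat.mul_ne_zero hk2.ne' (by omega))
  · calc k ^ 2 * m ≤ K ^ 2 * M := Nat.mul_le_mul (Nat.pow_le_pow_left hkK 2) hm.2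
      _ ≤ Q := hQ

/-- **Master inequality** (pointwise form of SieveToMAvg step (i)). For `x ≥ 1`, `ε > 0`, `h ≥ 1`
and a cut-off `K` with `K² ⌊x^ε⌋ ≤ ⌊x^{2ε}⌋`:
`∑_{m ≤ x^ε} log m · |∑_{d ≤ x/m} μ(d) Λ(d m + h)|
  ≤ ε log x · ( K · ∑_{q ≤ x^{2ε}} |∑_{e ≤ x/q} λ(e) Λ(e q + h)| + x log(x+h) (1 + ε log x) · 2/(K+1) )`.
The first term collects the dilations `q = k² m` with `k ≤ K` (each `k` injectively), the second
is the trivial bound on the tail `k > K` (`∑_{m} 1/m ≤ 1 + ε log x`, `∑_{k > K} 1/k² ≤ 2/(K+1)`). -/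
theorem sum_log_mul_abs_moebiusSlice_le {x ε : ℝ} (hx : 1 ≤ x) (hε : 0 < ε) {h : ℕ} (hh : 1 ≤ h)
    {K : ℕ} (hK : K ^ 2 * ⌊x ^ ε⌋₊ ≤ ⌊x ^ (2 * ε)⌋₊) :
    ∑ m ∈ Icc 1 ⌊x ^ ε⌋₊, Real.log m * |∑ d ∈ Icc 1 ⌊x / m⌋₊, (μ d : ℝ) * Λ (d * m + h)|
      ≤ ε * Real.log x *
          (K * ∑ q ∈ Icc 1 ⌊x ^ (2 * ε)⌋₊, |∑ e ∈ Icc 1 ⌊x / q⌋₊, (liouville e : ℝ) * Λ (e * q + h)|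
            + x * Real.log (x + h) * (1 + ε * Real.log x) * (2 / (K + 1))) := by
  set M := ⌊x ^ ε⌋₊ with hM
  set Q := ⌊x ^ (2 * ε)⌋₊ with hQ
  set N := ⌊x⌋₊ + K with hN
  have hx0 : 0 ≤ x := by linarith
  have hxpos : 0 < x := by linarith
  have hlogx : 0 ≤ Real.log x := Real.log_nonneg hx
  have hh' : (1 : ℝ) ≤ h := by exact_mod_cast hh
  have hlogxh : 0 ≤ Real.log (x + h) := Real.log_nonneg (by linarith)
  set U : ℕ → ℝ := fun q => ∑ e ∈ Icc 1 ⌊x / q⌋₊, (liouville e : ℝ) * Λ (e * q + h) with hU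
  -- Step 1: squarefree decomposition and `|μ| ≤ 1`.
  have h1 : ∀ m ∈ Icc 1 M, |∑ d ∈ Icc 1 ⌊x / m⌋₊, (μ d : ℝ) * Λ (d * m + h)|
      ≤ ∑ k ∈ Icc 1 N, |U (k ^ 2 * m)| := by
    intro m hm
    rw [mem_Icc] at hm
    have hm1 : (1 : ℝ) ≤ m := by exact_mod_cast hm.1
    have hmN : ⌊x / m⌋₊ ≤ N :=
      calc ⌊x / m⌋₊ ≤ ⌊x⌋₊ := Nat.floor_le_floor (div_le_self hx0 hm1)
        _ ≤ N := Nat.le_add_right _ _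
    rw [moebiusSlice_eq_sum_moebius_mul_liouvilleSlice x m h hmN]
    refine (Finset.abs_sum_le_sum_abs _ _).trans (Finset.sum_le_sum (fun k _ => ?_))
    rw [abs_mul]
    calc |(μ k : ℝ)| * |U (k ^ 2 * m)| ≤ 1 * |U (k ^ 2 * m)| :=
          mul_le_mul_of_nonneg_right
            (Literature.NumberTheory.LFunctions.abs_moebius_real_le_one k) (abs_nonneg _)
      _ = |U (k ^ 2 * m)| := one_mul _
  -- Step 2: `log m ≤ ε log x` on the range.
  have h2 : ∀ m ∈ Icc 1 M, Real.log m ≤ ε * Real.log x := by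
    intro m hm
    rw [mem_Icc] at hm
    have hmpos : (0 : ℝ) < m := by exact_mod_cast hm.1
    have hmle : (m : ℝ) ≤ x ^ ε := (Nat.le_floor_iff (Real.rpow_nonneg hx0 ε)).mp hm.2
    calc Real.log m ≤ Real.log (x ^ ε) := Real.log_le_log hmpos hmle
      _ = ε * Real.log x := Real.log_rpow hxpos ε
  -- Step 3: combine Steps 1 and 2.
  have h3 : ∑ m ∈ Icc 1 M, Real.log m * |∑ d ∈ Icc 1 ⌊x / m⌋₊, (μ d : ℝ) * Λ (d * m + h)|
      ≤ ε * Real.log x * ∑ m ∈ Icc 1 M, ∑ k ∈ Icc 1 N, |U (k ^ 2 * m)| := by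
    rw [Finset.mul_sum]
    refine Finset.sum_le_sum (fun m hm => ?_)
    exact mul_le_mul (h2 m hm) (h1 m hm) (abs_nonneg _) (mul_nonneg hε.le hlogx)
  -- Step 4: split the `k`-range at `K`.
  have hsplit : ∀ m : ℕ, ∑ k ∈ Icc 1 N, |U (k ^ 2 * m)|
      = ∑ k ∈ Icc 1 K, |U (k ^ 2 * m)| + ∑ k ∈ Ioc K N, |U (k ^ 2 * m)| := by
    intro m
    rw [← Finset.sum_union]
    · congr 1
      ext k
      simp only [mem_union, mem_Icc, mem_Ioc]
      omega
    · rw [Finset.disjoint_left]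
      intro k hk1 hk2
      rw [mem_Icc] at hk1
      rw [mem_Ioc] at hk2
      omega
  -- Step 5: the dilations `k ≤ K`, each injective into `q ≤ x^{2ε}`.
  have hmain : ∑ m ∈ Icc 1 M, ∑ k ∈ Icc 1 K, |U (k ^ 2 * m)| ≤ K * ∑ q ∈ Icc 1 Q, |U q| := by
    rw [Finset.sum_comm]
    calc ∑ k ∈ Icc 1 K, ∑ m ∈ Icc 1 M, |U (k ^ 2 * m)|
        ≤ ∑ k ∈ Icc 1 K, ∑ q ∈ Icc 1 Q, |U q| := by
          refine Finset.sum_le_sum (fun k hk => ?_)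
          rw [mem_Icc] at hk
          exact sum_Icc_comp_sq_mul_le hk.1 hk.2 hK (fun q => |U q|) (fun q => abs_nonneg _)
      _ = K * ∑ q ∈ Icc 1 Q, |U q| := by
          rw [Finset.sum_const, Nat.card_Icc, Nat.add_sub_cancel, nsmul_eq_mul]
  -- Step 6: the tail `k > K`, trivially.
  have htail : ∑ m ∈ Icc 1 M, ∑ k ∈ Ioc K N, |U (k ^ 2 * m)|
      ≤ x * Real.log (x + h) * (1 + ε * Real.log x) * (2 / (K + 1)) := by
    have hharm : ∑ m ∈ Icc 1 M, (m : ℝ)⁻¹ ≤ 1 + ε * Real.log x := by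
      rw [show Icc 1 M = Ioc 0 M from Finset.Icc_add_one_left_eq_Ioc 0 M]
      refine (Literature.NumberTheory.LFunctions.LiouvilleSum.sum_Ioc_inv_le_one_add_log M).trans ?_
      rcases Nat.eq_zero_or_pos M with hM0 | hMpos
      · rw [hM0, Nat.cast_zero, Real.log_zero]
        linarith [mul_nonneg hε.le hlogx]
      · have hMpos' : (0 : ℝ) < M := by exact_mod_cast hMpos
        have hMle : (M : ℝ) ≤ x ^ ε := Nat.floor_le (Real.rpow_nonneg hx0 ε)
        have := Real.log_le_log hMpos' hMle
        rw [Real.log_rpow hxpos] at this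
        linarith
    calc ∑ m ∈ Icc 1 M, ∑ k ∈ Ioc K N, |U (k ^ 2 * m)|
        ≤ ∑ m ∈ Icc 1 M, ∑ k ∈ Ioc K N,
            x * Real.log (x + h) * ((m : ℝ)⁻¹ * ((k : ℝ) ^ 2)⁻¹) := by
          refine Finset.sum_le_sum (fun m hm => Finset.sum_le_sum (fun k hk => ?_))
          rw [mem_Icc] at hm
          rw [mem_Ioc] at hk
          have hk0 : k ≠ 0 := by omega
          have hm0 : m ≠ 0 := by omega
          have hkm : 1 ≤ k ^ 2 * m :=
            Nat.one_le_iff_ne_zero.mpr (Nat.mul_ne_zero (pow_ne_zero 2 hk0) hm0)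
          calc |U (k ^ 2 * m)| ≤ x / (k ^ 2 * m : ℕ) * Real.log (x + h) :=
                abs_liouvilleSlice_le hx0 hkm hh
            _ = x * Real.log (x + h) * ((m : ℝ)⁻¹ * ((k : ℝ) ^ 2)⁻¹) := by
                have hk0' : (k : ℝ) ≠ 0 := by exact_mod_cast hk0
                have hm0' : (m : ℝ) ≠ 0 := by exact_mod_cast hm0
                push_cast
                field_simp
      _ = x * Real.log (x + h) *
            ((∑ m ∈ Icc 1 M, (m : ℝ)⁻¹) * ∑ k ∈ Ioc K N, ((k : ℝ) ^ 2)⁻¹) := by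
          rw [Finset.sum_mul_sum, Finset.mul_sum]
          refine Finset.sum_congr rfl (fun m _ => ?_)
          rw [Finset.mul_sum]
      _ ≤ x * Real.log (x + h) * ((1 + ε * Real.log x) * (2 / (K + 1))) := by
          apply mul_le_mul_of_nonneg_left _ (mul_nonneg hx0 hlogxh)
          exact mul_le_mul hharm (sum_Ioc_inv_sq_le_two_div K N)
            (Finset.sum_nonneg (fun _ _ => by positivity)) (by nlinarith [mul_nonneg hε.le hlogx])
      _ = x * Real.log (x + h) * (1 + ε * Real.log x) * (2 / (K + 1)) := by ring
  -- Step 7: assemble.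
  calc ∑ m ∈ Icc 1 M, Real.log m * |∑ d ∈ Icc 1 ⌊x / m⌋₊, (μ d : ℝ) * Λ (d * m + h)|
      ≤ ε * Real.log x * ∑ m ∈ Icc 1 M, ∑ k ∈ Icc 1 N, |U (k ^ 2 * m)| := h3
    _ = ε * Real.log x * (∑ m ∈ Icc 1 M, ∑ k ∈ Icc 1 K, |U (k ^ 2 * m)|
          + ∑ m ∈ Icc 1 M, ∑ k ∈ Ioc K N, |U (k ^ 2 * m)|) := by
        rw [← Finset.sum_add_distrib]
        exact congrArg _ (Finset.sum_congr rfl (fun m _ => hsplit m))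
    _ ≤ ε * Real.log x * (K * ∑ q ∈ Icc 1 Q, |U q|
          + x * Real.log (x + h) * (1 + ε * Real.log x) * (2 / (K + 1))) :=
        mul_le_mul_of_nonneg_left (add_le_add hmain htail) (mul_nonneg hε.le hlogx)

end Summit.Parity.GeneralizedHardyLittlewood.Theorems.MAvg
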